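import Mathlib
import HarnessLib
import Summits.HubbardSuperconductivity.HubbardSuperconductivity.Theorems.KLProgrammeH10TwoPointLimitPerturbedCountPairsThinRanges
import Summits.HubbardSuperconductivity.HubbardSuperconductivity.Theorems.KLProgrammeH10TwoPointLimitPerturbedCountFoldThinBound
import Summits.HubbardSuperconductivity.HubbardSuperconductivity.Theorems.KLProgrammeH10TwoPointLimitPerturbedCountBridge

/-!
# Route `KLProgramme` — K3 engine child `KLRegimeEngineV17F2` (stmt-HubbardSuperconductivity-20437), stub (b) import ι₂:
# the THIN anchored pair count on the perturbed curve — `#{near-solution pairs} ≤ K_p / w` (no `J + 1`, no `log N`)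

Cell gate-hubbard-kl, plan g17 (R41)(i) «E1-P2-THIN-COUNT» (seat p4; assembly, part 2 = the thin twin of `count_pairs_perturbed_exists`).  For the
anchor `p_E(θ₁)` ON the perturbed curve and the grid `θ_i = w/2 + i·w` (`Nw = 2π`), the number of pairs `(a, c)` admitting a near-solution
(`(θ₁′, x′, y′)` within `w` of `(θ₁, θ_a, θ_c)` with `|h^E_{p_E(θ₁′)}(x′, y′)| ≤ C_r w²` — what a triple of THIN sectors of angular width `w` and
thickness `≍ w²` with a fourth thin sector closing the momentum produces, file 5) is `≤ K_p / w`, `K_p` depending only on the `BandBounds` fields,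
`κ₀, κ₁, κ₂`, `C_r` and the small constants: the transversal families at the fat tolerance (`count_transversal_pc`), the Cooper range at the thin affine
tolerance (`count_odd_total_affine_perturbed`, shifts `|kw − π| < 3w` trivially), the two fold ranges through the thin two-regime row sum
(`count_anti_total_thin_perturbed`, `two_regime_bound_le_div`); no `|h|` (Mastropietro 2008 (14.67)).  **`count_pairs_thin_perturbed_exists`**.
Everything is PROVED; no definitions.  References: [cite: BenfattoGiulianiMastropietro2006] Lemma 3.1 / (2.80) / App. A2–A3; [cite: Mastropietro2008] (14.67)
p. 223, p. 229.
-/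

noncomputable section

namespace Summit.HubbardSuperconductivity.HubbardSuperconductivity.Theorems.PerturbedFermiCurve

set_option linter.dupNamespace false -- summit = problem name (single-conjunct summit), D-0017

open Classical
open Real Set
open Literature.MathematicalPhysics.QuantumLattice Literature.MathematicalPhysics.QuantumLattice.BandSectorCounting

set_option maxHeartbeats 1600000 in
/-- **The thin two-dimensional count on the perturbed curve.**  Under the smallness conditions of the transversal / covering / Cooper / fold /
stratum / rigidity / kill lemmas (in the named constants `pc*`), there is `K_p` such that for every `C²` even `δ` of size `(κ₀, κ₁, κ₂)`, every level `μ`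
with margin `m₀`, every root selection `u`, every anchor angle `θ₁` and every grid `Nw = 2π` with `w` small (`(C_r + 3(4+κ₁)S_E)w`,
`(C_c + K₁τ)w`, `(C₀ + 2K₃π + K₃τ)w ≤ η₀F/2`), the number of grid pairs with a near-solution at radius `C_r w²` is `≤ K_p / w`.
[cite: BenfattoGiulianiMastropietro2006, Lemma 3.1 / (2.80) / App. A2–A3] -/
theorem count_pairs_thin_perturbed_exists {a b : ℝ} (B : BandBounds a b) {κ₀ κ₁ κ₂ Cr τ lam η₀F η₀K η₀'' η₁'' η₀S η₁S R m₀ : ℝ}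
    (hκ₁0 : 0 ≤ κ₁) (hκ₁ : κ₁ < B.Dtmin) (hκ₂0 : 0 ≤ κ₂) (hCr : 0 < Cr)
    (hτ : 0 < τ) (hτπ : τ < π) (hlam : 0 < lam) (hη₀F : 0 < η₀F)
    (hm₀F : η₀F ≤ m₀) (hm₀S : η₀S ≤ m₀) (hm₀'' : η₀'' ≤ m₀) (hm₀K : η₀K ≤ m₀)
    -- covering and Cooper
    (hcov : 2 * (B.Cg * pcE4 B κ₀ κ₁ lam η₀F) ≤ τ)
    (hodd : pcOdd B κ₀ κ₁ κ₂ (2 * lam) η₀F τ ≤ B.hmin / 2) (hκA : κ₁ * pcAE B κ₁ κ₂ ≤ B.hmin / 2)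
    -- fold rows
    (hevenF : pcEven B κ₀ κ₁ κ₂ lam η₀F τ ≤ B.hmin / 2)
    (hη₀S : 0 < η₀S) (hη₁S : 0 < η₁S) (hdiagS : pcDiag B κ₀ κ₁ κ₂ η₀S η₁S ≤ 2 * B.hmin)
    (hη₀'' : 0 < η₀'') (hR : 0 < R) (hthr₀ : η₀'' + pcMdiag B κ₁ * R ≤ η₀S) (hthr₁ : η₁'' + pcAdiag B κ₁ κ₂ * R ≤ η₁S)
    (hthr₂ : η₁'' ≤ 2 * B.hmin * R / 4) (hCgap : 2 * lam + pcMG B κ₁ κ₂ * τ ≤ η₁'')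
    (hρ3 : 2 * (η₀'' / B.Dtmin + 2 * κ₀ / B.Dtmin + B.smax * (B.Cg * pcE4 B κ₀ κ₁ (η₁'' / 2) η₀'')) < B.rhomin ^ 2)
    (hhalf3 : η₀'' / B.Dtmin + 2 * κ₀ / B.Dtmin + B.smax * (B.Cg * pcE4 B κ₀ κ₁ (η₁'' / 2) η₀'') < 1 / 2)
    (hmargin3 : π * (η₀'' / B.Dtmin + 2 * κ₀ / B.Dtmin + B.smax * (B.Cg * pcE4 B κ₀ κ₁ (η₁'' / 2) η₀'')) + 2 * umklappRadius b < 2 * π)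
    (hm₁ : pcAdiag B κ₁ κ₂ * (π * (π * (η₀'' / B.Dtmin + 2 * κ₀ / B.Dtmin + B.smax * (B.Cg * pcE4 B κ₀ κ₁ (η₁'' / 2) η₀'')) /
      (Real.sqrt 2 * B.umin))) ≤ η₁S)
    (hm₁' : pcAdiag B κ₁ κ₂ * (π * (π * (η₀'' / B.Dtmin + 2 * κ₀ / B.Dtmin + B.smax * (B.Cg * pcE4 B κ₀ κ₁ (η₁'' / 2) η₀'')) /
      (Real.sqrt 2 * B.umin))) ^ 2 ≤ η₀S)
    (hη₀K : 2 * η₀'' ≤ η₀K) (hevenK : pcEven B κ₀ κ₁ κ₂ (η₁'' / 2) η₀K τ ≤ B.hmin / 2)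
    (hρK : 2 * (η₀K / B.Dtmin + 2 * κ₀ / B.Dtmin +
      B.smax * (B.Cg * pcE4 B κ₀ κ₁ (2 * (η₁'' / 2) + (4 + κ₁) * pcAE B κ₁ κ₂ * τ / 2) η₀K + τ / 2)) < B.rhomin ^ 2)
    (hτηK : pcManti B κ₁ κ₂ * τ ^ 2 ≤ η₀K / 2) (hτlamK : pcMG B κ₁ κ₂ * τ ≤ 2 * (η₁'' / 2))
    (hιK : 3 * pcSE B κ₁ * τ < B.rhomin ^ 2 - 2 * (η₀'' / B.Dtmin + 2 * κ₀ / B.Dtmin + B.smax * (B.Cg * pcE4 B κ₀ κ₁ (η₁'' / 2) η₀''))) :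
    ∃ Kp : ℝ, 0 < Kp ∧ ∀ δ : (Fin 2 → ℝ) → ℝ, ContDiff ℝ 2 δ → (∀ k, δ (-k) = δ k) →
      (∀ k : Fin 2 → ℝ, |δ k| ≤ κ₀) → (∀ k : Fin 2 → ℝ, ‖fderiv ℝ δ k‖ ≤ κ₁) → (∀ k : Fin 2 → ℝ, ‖fderiv ℝ (fderiv ℝ δ) k‖ ≤ κ₂) →
      ∀ μ : ℝ, a ≤ μ - κ₀ - m₀ → μ + κ₀ + m₀ ≤ b →
      ∀ u : ℝ → ℝ, (∀ θ, IsBandFermiRadius (μ - δ (u θ • dir θ)) θ (u θ)) →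
      ∀ (θ₁ w : ℝ) (N Nh : ℕ), 0 < w → w ≤ 1 → (N : ℝ) * w = 2 * π → (Nh : ℝ) * w = π → N = 2 * Nh →
        (Cr + 3 * ((4 + κ₁) * pcSE B κ₁)) * w ≤ η₀F / 2 →
        ((Cr + 2 * Cr / 1 + 2 * (5 * ((4 + κ₂) * pcSE B κ₁ ^ 2) + 3 * ((4 + κ₁) * pcAE B κ₁ κ₂)) +
            (8 * ((4 + κ₂) * pcSE B κ₁ ^ 2) + 2 * ((4 + κ₁) * pcAE B κ₁ κ₂))) +
          (5 * ((4 + κ₂) * pcSE B κ₁ ^ 2) + 3 * ((4 + κ₁) * pcAE B κ₁ κ₂)) * τ) * w ≤ η₀F / 2 →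
        ((Cr + 8 * (3 * ((4 + κ₂) * pcSE B κ₁ ^ 2) + 2 * ((4 + κ₁) * pcAE B κ₁ κ₂))) +
          2 * (3 * ((4 + κ₂) * pcSE B κ₁ ^ 2) + 2 * ((4 + κ₁) * pcAE B κ₁ κ₂)) * π +
          (3 * ((4 + κ₂) * pcSE B κ₁ ^ 2) + 2 * ((4 + κ₁) * pcAE B κ₁ κ₂)) * τ) * w ≤ η₀F / 2 →
        ((((Finset.range N ×ˢ Finset.range N).filter fun p : ℕ × ℕ =>
            ∃ θ₁' x' y' : ℝ, |θ₁ - θ₁'| ≤ w ∧ |w / 2 + p.1 * w - x'| ≤ w ∧ |w / 2 + p.2 * w - y'| ≤ w ∧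
              |hfunE δ u μ (XE u θ₁', YE u θ₁') x' y'| ≤ Cr * w ^ 2).card : ℝ)) ≤ Kp / w := by
  have hs := B.smax_pos; have hh := B.hmin_pos; have hCg := B.Cg_pos; have hDt := B.Dtmin_pos; have hπ := Real.pi_pos
  obtain ⟨-, hSE, -, -, hAE, hMG, hMa, hMd, hAd⟩ := pc_pos B hκ₁0 hκ₁ hκ₂0
  -- abbreviations of the thin-tolerance constants
  set SE := pcSE B κ₁ with hSEdef
  set AE := pcAE B κ₁ κ₂ with hAEdef
  set K₁ := 5 * ((4 + κ₂) * SE ^ 2) + 3 * ((4 + κ₁) * AE) with hK₁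
  set K₂ := 8 * ((4 + κ₂) * SE ^ 2) + 2 * ((4 + κ₁) * AE) with hK₂
  set K₃ := 3 * ((4 + κ₂) * SE ^ 2) + 2 * ((4 + κ₁) * AE) with hK₃
  set Kfat := Cr + 3 * ((4 + κ₁) * SE) with hKfat
  set Cc := Cr + 2 * Cr / 1 + 2 * K₁ + K₂ with hCc
  set C₀ := Cr + 8 * K₃ with hC₀
  have hK₁0 : 0 ≤ K₁ := by rw [hK₁]; positivity
  have hK₃0 : 0 ≤ K₃ := by rw [hK₃]; positivity
  have hKfat0 : 0 < Kfat := by rw [hKfat]; positivity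
  have hCc0 : 0 < Cc := by rw [hCc]; positivity
  have hC₀0 : 0 < C₀ := by rw [hC₀]; positivity
  -- the big constants
  obtain ⟨CT, hCT⟩ : ∃ CT : ℝ, CT = (2 * π / (lam / (2 * pcMG B κ₁ κ₂)) + 1) * (2 * (4 * Kfat / lam + 1)) := ⟨_, rfl⟩
  obtain ⟨C₅, hC₅⟩ : ∃ C₅ : ℝ, C₅ = 2 * π / min (η₀F / (2 * ((4 + κ₁) * pcAE B κ₁ κ₂ * τ))) (lam / pcMG B κ₁ κ₂) + 1 := ⟨_, rfl⟩
  obtain ⟨Pc, hPc⟩ : ∃ Pc : ℝ, Pc = τ / min (η₀F / (2 * pcManti B κ₁ κ₂ * τ)) (2 * lam / pcMG B κ₁ κ₂) + 1 := ⟨_, rfl⟩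
  obtain ⟨X, hX⟩ : ∃ X : ℝ, X = 32 * (4 * π / min (η₀S / (2 * pcMdiag B κ₁)) (η₁S / (4 * pcAdiag B κ₁ κ₂)) + 1) / η₁S + 16 * π / η₀S := ⟨_, rfl⟩
  obtain ⟨Y, hY⟩ : ∃ Y : ℝ, Y = 8 * (4 * π / min (η₀S / (2 * pcMdiag B κ₁)) (η₁S / (4 * pcAdiag B κ₁ κ₂)) + 1) / Real.sqrt (2 * B.hmin) := ⟨_, rfl⟩
  obtain ⟨Z, hZ⟩ : ∃ Z : ℝ, Z = 2 * (4 * π / min (η₀S / (2 * pcMdiag B κ₁)) (η₁S / (4 * pcAdiag B κ₁ κ₂)) + 1) := ⟨_, rfl⟩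
  set D₁ := C₀ + 2 * K₃ * π with hD₁
  set D₂ := 2 * (D₁ + K₃ * τ) with hD₂
  obtain ⟨KF, hKF⟩ : ∃ KF : ℝ, KF = 8 * π * ((2 * Pc + 8 * Pc * K₃ / B.hmin) + 8 * Pc * D₁ * Real.sqrt (2 * pcManti B κ₁ κ₂) / (B.hmin * Real.sqrt η₀'') +
            (8 * Pc * Real.sqrt (2 * pcManti B κ₁ κ₂) / B.hmin) * (Real.sqrt (C₀ / 2) + 2 * K₃ / Real.sqrt B.hmin)) +
          4 * Pc * Real.sqrt (2 * D₁ / B.hmin) * (X * D₂ + Z + Y * Real.sqrt D₂) +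
          (8 * Pc * D₁ * Real.sqrt (2 * pcManti B κ₁ κ₂) / B.hmin) * ((16 * π / R + 1) * (4 / Real.sqrt (2 * C₀) + 22 / Real.sqrt (2 * B.hmin))) := ⟨_, rfl⟩
  have hℓT : 0 < lam / (2 * pcMG B κ₁ κ₂) := by positivity
  have hℓO : 0 < min (η₀F / (2 * ((4 + κ₁) * pcAE B κ₁ κ₂ * τ))) (lam / pcMG B κ₁ κ₂) := lt_min (by positivity) (by positivity)
  have hℓ₅ : 0 < min (η₀F / (2 * pcManti B κ₁ κ₂ * τ)) (2 * lam / pcMG B κ₁ κ₂) := lt_min (by positivity) (by positivity)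
  have hℓ₄ : 0 < min (η₀S / (2 * pcMdiag B κ₁)) (η₁S / (4 * pcAdiag B κ₁ κ₂)) := lt_min (by positivity) (by positivity)
  have hCT0 : 0 ≤ CT := by rw [hCT]; positivity
  have hC₅0 : 0 ≤ C₅ := by rw [hC₅]; positivity
  have hPc0 : 0 ≤ Pc := by rw [hPc]; positivity
  have hX0 : 0 ≤ X := by rw [hX]; positivity
  have hY0 : 0 ≤ Y := by rw [hY]; positivity
  have hZ0 : 0 ≤ Z := by rw [hZ]; positivity
  have hD₁0 : 0 ≤ D₁ := by rw [hD₁]; positivity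
  have hD₂0 : 0 < D₂ := by rw [hD₂]; positivity
  have hKF0 : 0 ≤ KF := by rw [hKF]; positivity
  -- the final constant
  refine ⟨2 * (2 * π * CT) + (2 * π + 2 * KF) + (7 * (2 * π) + (2 * π + 2 * C₅ * (4 * Cc / (B.hmin / 2) * (2 * π) + 4 * K₁ / (B.hmin / 2) * (2 * π) + 2 * π))) + 1,
    by positivity, ?_⟩
  intro δ hδs heven hδ hκ hκ₂ μ hlom hhim u hu θ₁ w N Nh hw hw1 hN hNh hNN hwfat hwcoop hwfold
  have hlo : a ≤ μ - κ₀ := by linarith only [hlom, hm₀F, hη₀F]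
  have hhi : μ + κ₀ ≤ b := by linarith only [hhim, hm₀F, hη₀F]
  have hloF : a ≤ μ - κ₀ - η₀F := by linarith only [hlom, hm₀F]
  have hhiF : μ + κ₀ + η₀F ≤ b := by linarith only [hhim, hm₀F]
  have hloS : a ≤ μ - κ₀ - η₀S := by linarith only [hlom, hm₀S]
  have hhiS : μ + κ₀ + η₀S ≤ b := by linarith only [hhim, hm₀S]
  have hlo'' : a ≤ μ - κ₀ - η₀'' := by linarith only [hlom, hm₀'']
  have hhi'' : μ + κ₀ + η₀'' ≤ b := by linarith only [hhim, hm₀'']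
  have hloK : a ≤ μ - κ₀ - η₀K := by linarith only [hlom, hm₀K]
  have hhiK : μ + κ₀ + η₀K ≤ b := by linarith only [hhim, hm₀K]
  have hN0 : (0 : ℝ) < N := by
    have : (0:ℝ) < N * w := by rw [hN]; positivity
    exact pos_of_mul_pos_left this hw.le
  have hNpos : 0 < N := Nat.pos_of_ne_zero (fun h0 => by rw [h0] at hN0; simp at hN0)
  have hN1 : (1 : ℝ) ≤ N := by exact_mod_cast hNpos
  have hNw : (N : ℝ) = 2 * π / w := by field_simp; linarith only [hN]
  have hw2 : w ^ 2 ≤ w := by rw [sq]; exact mul_le_of_le_one_left hw.le hw1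
  have hCrw : Cr * w ^ 2 ≤ Cr * w := mul_le_mul_of_nonneg_left hw2 hCr.le
  set P : ℝ × ℝ := (XE u θ₁, YE u θ₁) with hP
  -- the fat tolerance implied by a near-solution
  have hfat : ∀ a' c' : ℕ, (∃ θ₁' x' y' : ℝ, |θ₁ - θ₁'| ≤ w ∧ |w / 2 + a' * w - x'| ≤ w ∧ |w / 2 + c' * w - y'| ≤ w ∧
              |hfunE δ u μ (XE u θ₁', YE u θ₁') x' y'| ≤ Cr * w ^ 2) → |hfunE δ u μ P (w / 2 + a' * w) (w / 2 + c' * w)| ≤ Kfat * w := by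
    intro a' c' h
    obtain ⟨θ₁', x', y', h1, h2, h3, h4⟩ := h
    have := abs_hfunE_le_fat B hδs hδ hlo hhi hκ hκ₁ hu h4 h1 h2 h3
    rw [hKfat]; linarith only [this, hCrw]
  -- the three families
  set S := Finset.range N ×ˢ Finset.range N with hS
  set PP := S.filter (fun p : ℕ × ℕ => (∃ θ₁' x' y' : ℝ, |θ₁ - θ₁'| ≤ w ∧ |w / 2 + p.1 * w - x'| ≤ w ∧ |w / 2 + p.2 * w - y'| ≤ w ∧
              |hfunE δ u μ (XE u θ₁', YE u θ₁') x' y'| ≤ Cr * w ^ 2)) with hPP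
  set P₃ := S.filter (fun p : ℕ × ℕ => |hfunE δ u μ P (w / 2 + p.1 * w) (w / 2 + p.2 * w)| ≤ Kfat * w ∧
    lam ≤ |h3E δ u P (w / 2 + p.1 * w) (w / 2 + p.2 * w)|) with hP₃
  set P₂ := S.filter (fun p : ℕ × ℕ => |hfunE δ u μ P (w / 2 + p.1 * w) (w / 2 + p.2 * w)| ≤ Kfat * w ∧
    lam ≤ |h3E δ u P (w / 2 + p.2 * w) (w / 2 + p.1 * w)|) with hP₂
  set P₀ := S.filter (fun p : ℕ × ℕ => (∃ θ₁' x' y' : ℝ, |θ₁ - θ₁'| ≤ w ∧ |w / 2 + p.1 * w - x'| ≤ w ∧ |w / 2 + p.2 * w - y'| ≤ w ∧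
              |hfunE δ u μ (XE u θ₁', YE u θ₁') x' y'| ≤ Cr * w ^ 2) ∧
    |h3E δ u P (w / 2 + p.1 * w) (w / 2 + p.2 * w)| < lam ∧ |h3E δ u P (w / 2 + p.2 * w) (w / 2 + p.1 * w)| < lam) with hP₀
  have hsub : PP ⊆ P₃ ∪ (P₂ ∪ P₀) := by
    intro p hp
    rw [hPP, Finset.mem_filter] at hp
    rw [Finset.mem_union, Finset.mem_union, hP₃, hP₂, hP₀, Finset.mem_filter, Finset.mem_filter, Finset.mem_filter]
    have hf := hfat p.1 p.2 hp.2
    by_cases h3a : lam ≤ |h3E δ u P (w / 2 + p.1 * w) (w / 2 + p.2 * w)|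
    · exact Or.inl ⟨hp.1, hf, h3a⟩
    · by_cases h3b : lam ≤ |h3E δ u P (w / 2 + p.2 * w) (w / 2 + p.1 * w)|
      · exact Or.inr (Or.inl ⟨hp.1, hf, h3b⟩)
      · exact Or.inr (Or.inr ⟨hp.1, hp.2, not_le.1 h3a, not_le.1 h3b⟩)
  have hcardP : (PP.card : ℝ) ≤ (P₃.card : ℝ) + (P₂.card : ℝ) + (P₀.card : ℝ) := by
    have e1 := Finset.card_le_card hsub
    have e2 := Finset.card_union_le P₃ (P₂ ∪ P₀)
    have e3 := Finset.card_union_le P₂ P₀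
    have : PP.card ≤ P₃.card + P₂.card + P₀.card := by omega
    exact_mod_cast this
  -- the transversal families (fat tolerance)
  have hδ0 : 0 ≤ Kfat * w := by positivity
  have hC₃eq : (2 * π / (lam / (2 * pcMG B κ₁ κ₂)) + 1) * (2 * ((4 * (Kfat * w) / lam) / w + 1)) = CT := by
    rw [hCT]; congr 2; field_simp
  have hP₃ : (P₃.card : ℝ) ≤ N * CT := by
    calc (P₃.card : ℝ) = ∑ i ∈ Finset.range N, ((((Finset.range N).filter fun c : ℕ =>
          |hfunE δ u μ P (w / 2 + i * w) (w / 2 + c * w)| ≤ Kfat * w ∧ lam ≤ |h3E δ u P (w / 2 + i * w) (w / 2 + c * w)|).card : ℝ)) :=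
          card_filter_prod_eq_sum N (fun i c : ℕ => |hfunE δ u μ P (w / 2 + i * w) (w / 2 + c * w)| ≤ Kfat * w ∧
            lam ≤ |h3E δ u P (w / 2 + i * w) (w / 2 + c * w)|)
      _ ≤ N * ((2 * π / (lam / (2 * pcMG B κ₁ κ₂)) + 1) * (2 * ((4 * (Kfat * w) / lam) / w + 1))) :=
          count_transversal_pc B hδs hδ hlo hhi hκ hκ₁ hκ₂ hu hw hlam hδ0 hN hMG
      _ = N * CT := by rw [hC₃eq]
  have hP₂ : (P₂.card : ℝ) ≤ N * CT := by
    calc (P₂.card : ℝ) = ∑ c ∈ Finset.range N, ((((Finset.range N).filter fun i : ℕ =>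
          |hfunE δ u μ P (w / 2 + i * w) (w / 2 + c * w)| ≤ Kfat * w ∧ lam ≤ |h3E δ u P (w / 2 + c * w) (w / 2 + i * w)|).card : ℝ)) :=
          card_filter_prod_eq_sum' N (fun i c : ℕ => |hfunE δ u μ P (w / 2 + i * w) (w / 2 + c * w)| ≤ Kfat * w ∧
            lam ≤ |h3E δ u P (w / 2 + c * w) (w / 2 + i * w)|)
      _ ≤ N * ((2 * π / (lam / (2 * pcMG B κ₁ κ₂)) + 1) * (2 * ((4 * (Kfat * w) / lam) / w + 1))) :=
          count_transversal'_pc B hδs hδ hlo hhi hκ hκ₁ hκ₂ hu hw hlam hδ0 hN hMG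
      _ = N * CT := by rw [hC₃eq]
  -- the family with both partials small, reindexed by the shift
  set f : ℕ → ℝ := fun k => ((((Finset.range N).filter fun i : ℕ =>
        (∃ θ₁' x' y' : ℝ, |θ₁ - θ₁'| ≤ w ∧ |w / 2 + i * w - x'| ≤ w ∧ |w / 2 + i * w + k * w - y'| ≤ w ∧
          |hfunE δ u μ (XE u θ₁', YE u θ₁') x' y'| ≤ Cr * w ^ 2) ∧
        |h3E δ u P (w / 2 + i * w) (w / 2 + i * w + k * w)| < lam ∧ |h3E δ u P (w / 2 + i * w + k * w) (w / 2 + i * w)| < lam).card : ℝ)) with hf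
  have hP₀ : (P₀.card : ℝ) ≤ ∑ k ∈ Finset.range N, f k := by
    rw [hP₀, hS, hf]
    refine card_filter_prod_le_sum_shift (N := N) (fun a' c' => (∃ θ₁' x' y' : ℝ, |θ₁ - θ₁'| ≤ w ∧ |w / 2 + a' * w - x'| ≤ w ∧ |w / 2 + c' * w - y'| ≤ w ∧
              |hfunE δ u μ (XE u θ₁', YE u θ₁') x' y'| ≤ Cr * w ^ 2) ∧
      |h3E δ u P (w / 2 + a' * w) (w / 2 + c' * w)| < lam ∧ |h3E δ u P (w / 2 + c' * w) (w / 2 + a' * w)| < lam)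
      (fun i k => (∃ θ₁' x' y' : ℝ, |θ₁ - θ₁'| ≤ w ∧ |w / 2 + i * w - x'| ≤ w ∧ |w / 2 + i * w + k * w - y'| ≤ w ∧
          |hfunE δ u μ (XE u θ₁', YE u θ₁') x' y'| ≤ Cr * w ^ 2) ∧
        |h3E δ u P (w / 2 + i * w) (w / 2 + i * w + k * w)| < lam ∧ |h3E δ u P (w / 2 + i * w + k * w) (w / 2 + i * w)| < lam) ?_
    intro a' c' ha hc hQ
    obtain ⟨hns, hp1, hp2⟩ := hQ
    refine ⟨nearSol_shift B hδs hδ hlo hhi hκ hκ₁ hu hN ha hns, ?_, ?_⟩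
    · split_ifs with hle
      · have e : w / 2 + (a' : ℝ) * w + ((c' - a' : ℕ) : ℝ) * w = w / 2 + c' * w := by rw [Nat.cast_sub hle]; ring
        rw [e]; exact hp1
      · push Not at hle
        have e : w / 2 + (a' : ℝ) * w + ((c' + N - a' : ℕ) : ℝ) * w = w / 2 + c' * w + (1 : ℤ) * (2 * π) := by
          rw [Nat.cast_sub (by omega : a' ≤ c' + N)]; push_cast; rw [← hN]; ring
        rw [e, h3E_add_int_mul_two_pi_three B hδs hδ hlo hhi hκ hκ₁ hu]; exact hp1
    · split_ifs with hle
      · have e : w / 2 + (a' : ℝ) * w + ((c' - a' : ℕ) : ℝ) * w = w / 2 + c' * w := by rw [Nat.cast_sub hle]; ring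
        rw [e]; exact hp2
      · push Not at hle
        have e : w / 2 + (a' : ℝ) * w + ((c' + N - a' : ℕ) : ℝ) * w = w / 2 + c' * w + (1 : ℤ) * (2 * π) := by
          rw [Nat.cast_sub (by omega : a' ≤ c' + N)]; push_cast; rw [← hN]; ring
        rw [e, h3E_add_int_mul_two_pi_two B hδs hδ hlo hhi hκ hκ₁ hu]; exact hp2
  have hf0 : ∀ k, 0 ≤ f k := fun k => by positivity
  have hfN : ∀ k, f k ≤ N := by
    intro k
    rw [hf]; dsimp only
    have := Finset.card_filter_le (Finset.range N) (fun i : ℕ => (∃ θ₁' x' y' : ℝ, |θ₁ - θ₁'| ≤ w ∧ |w / 2 + i * w - x'| ≤ w ∧ |w / 2 + i * w + k * w - y'| ≤ w ∧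
          |hfunE δ u μ (XE u θ₁', YE u θ₁') x' y'| ≤ Cr * w ^ 2) ∧
        |h3E δ u P (w / 2 + i * w) (w / 2 + i * w + k * w)| < lam ∧ |h3E δ u P (w / 2 + i * w + k * w) (w / 2 + i * w)| < lam)
    rw [Finset.card_range] at this
    exact_mod_cast this
  -- the three shift ranges
  have hsplit := sum_split_three (N := N) f (fun k : ℕ => (k : ℝ) * w ≤ τ) (fun k : ℕ => |(k : ℝ) * w - π| ≤ τ)
    (fun k : ℕ => 2 * π - τ ≤ (k : ℝ) * w) hf0 (by
      intro k hk hfk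
      rw [Finset.mem_range] at hk
      have hne : ((Finset.range N).filter fun i : ℕ => (∃ θ₁' x' y' : ℝ, |θ₁ - θ₁'| ≤ w ∧ |w / 2 + i * w - x'| ≤ w ∧ |w / 2 + i * w + k * w - y'| ≤ w ∧
          |hfunE δ u μ (XE u θ₁', YE u θ₁') x' y'| ≤ Cr * w ^ 2) ∧
        |h3E δ u P (w / 2 + i * w) (w / 2 + i * w + k * w)| < lam ∧ |h3E δ u P (w / 2 + i * w + k * w) (w / 2 + i * w)| < lam).Nonempty := by
        rw [← Finset.card_pos]
        by_contra h0
        push Not at h0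
        have : f k = 0 := by rw [hf]; dsimp only; exact_mod_cast Nat.le_zero.1 h0
        exact hfk this
      obtain ⟨i, hi⟩ := hne
      rw [Finset.mem_filter] at hi
      obtain ⟨hns, hp1, hp2⟩ := hi.2
      have hfatk : |hfunE δ u μ P (w / 2 + i * w) (w / 2 + i * w + k * w)| ≤ Kfat * w := by
        have := abs_hfunE_shift_le_fat B hδs hδ hlo hhi hκ hκ₁ hu (θ₁ := θ₁) (Cr := Cr) (x := w / 2 + i * w) (y := w / 2 + i * w + k * w) hns
        rw [hKfat]; linarith only [this, hCrw]
      have hδη : Kfat * w ≤ η₀F := by linarith only [hwfat, hη₀F]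
      exact krange_pc B hδs hδ hlo hhi hκ hκ₁ hu hw hN hk hτπ hloF hhiF hδη hcov ⟨hfatk, hp1, hp2⟩)
  -- the fold rows (thin two-regime total), used for both fold ranges
  set mrow : ℕ → ℝ := fun s => |toIocMod Real.two_pi_pos (-π) (w / 2 + s * (w / 2) - θ₁ - π)| with hmrow
  set Rrow : ℕ → ℕ → Prop := fun s j =>
        |hfunE δ u μ P (w / 2 + s * (w / 2) - (w + j * w) / 2) (w / 2 + s * (w / 2) + (w + j * w) / 2)| ≤
            (C₀ * w ^ 2 + 2 * K₃ * w * mrow s) + K₃ * w * (w + j * w) ∧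
        |h3E δ u P (w / 2 + s * (w / 2) + (w + j * w) / 2) (w / 2 + s * (w / 2) - (w + j * w) / 2) +
          h3E δ u P (w / 2 + s * (w / 2) - (w + j * w) / 2) (w / 2 + s * (w / 2) + (w + j * w) / 2)| ≤ 2 * lam with hRrow
  set EE := ∑ s ∈ Finset.range (4 * N), ((((Finset.range ⌊τ / w⌋₊).filter fun j : ℕ => Rrow s j).card : ℝ)) with hEE
  have hEE_le : EE ≤ KF / w := by
    have hm : ∀ s, 0 ≤ mrow s ∧ mrow s ≤ π := fun s => ⟨abs_nonneg _, abs_toIocMod_two_pi_le_pi _⟩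
    have hmrep : ∀ (s : ℕ) (k : ℤ), mrow s ≤ |w / 2 + s * (w / 2) - k * (2 * π) - θ₁ - π| := by
      intro s k
      have := abs_toIocMod_two_pi_le (w / 2 + s * (w / 2) - θ₁ - π) k
      rw [show w / 2 + ↑s * (w / 2) - θ₁ - π - ↑k * (2 * π) = w / 2 + ↑s * (w / 2) - ↑k * (2 * π) - θ₁ - π by ring] at this
      exact this
    have hδηF : (C₀ * w ^ 2 + 2 * K₃ * w * π) + K₃ * w * τ ≤ η₀F / 2 := by
      have : (C₀ * w ^ 2 + 2 * K₃ * w * π) + K₃ * w * τ ≤ (C₀ + 2 * K₃ * π + K₃ * τ) * w := by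
        have h1 := mul_le_mul_of_nonneg_left hw2 hC₀0.le; linarith only [h1]
      exact this.trans hwfold
    have h4N : (((4 * N : ℕ)) : ℝ) = 8 * π / w := by push_cast; rw [hNw]; ring
    have hC₀w := mul_le_mul_of_nonneg_left hw2 hC₀0.le
    have hδM : C₀ * w ^ 2 + 2 * K₃ * w * π ≤ w * D₁ := by rw [hD₁]; linarith only [hC₀w]
    have hηB : 2 * ((C₀ * w ^ 2 + 2 * K₃ * w * π) + K₃ * w * τ) ≤ w * D₂ := by rw [hD₂, hD₁]; linarith only [hC₀w]
    have hE2 := two_regime_bound_le_div (Pc := Pc) (K₃ := K₃) (hm := B.hmin) (M := pcManti B κ₁ κ₂) (η₀'' := η₀'') (C₀ := C₀) (C₂ := 2 * K₃)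
      (cQ := B.hmin) (δM := C₀ * w ^ 2 + 2 * K₃ * w * π) (X := X) (Y := Y) (Z := Z) (ηB := 2 * ((C₀ * w ^ 2 + 2 * K₃ * w * π) + K₃ * w * τ))
      (R := R) (D₁ := D₁) (D₂ := D₂) (N' := ((4 * N : ℕ) : ℝ))
      (Λ := X * (2 * ((C₀ * w ^ 2 + 2 * K₃ * w * π) + K₃ * w * τ)) / w + Y * Real.sqrt (2 * ((C₀ * w ^ 2 + 2 * K₃ * w * π) + K₃ * w * τ)) / w + Z)
      hw hw1 hPc0 hh hMa hη₀'' hC₀0 hX0 hY0 hZ0 hR hD₂0 h4N hδM hηB le_rfl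
    rw [hEE]
    refine (count_anti_total_thin_perturbed B hδs heven hδ hlo hhi hκ hκ₁ hκ₂ hu (θ₁ := θ₁) (C₂ := 2 * K₃) (δ₁ := K₃ * w) mrow hw hN hC₀0
        (by positivity) (by positivity) hτ hlam hm hmrep hη₀F hδηF hloF hhiF hevenF hη₀S hη₁S hloS hhiS hdiagS hη₀'' hR hthr₀ hthr₁ hthr₂ hlo'' hhi''
        hCgap hρ3 hhalf3 hmargin3 hm₁ hm₁' hη₀K hloK hhiK hevenK hρK hτηK hτlamK hιK).trans ?_
    refine (le_of_eq ?_).trans (hE2.trans (le_of_eq ?_))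
    · rw [hPc, hX, hY, hZ]
    · rw [hKF]
  -- fold range `k w ≤ τ`
  have hA' : ∑ k ∈ (Finset.range N).filter (fun k : ℕ => (k : ℝ) * w ≤ τ), f k ≤ N + EE := by
    rw [hEE, hf]
    exact sum_fold_pos_le_of_imp hw (fun i k => (∃ θ₁' x' y' : ℝ, |θ₁ - θ₁'| ≤ w ∧ |w / 2 + i * w - x'| ≤ w ∧ |w / 2 + i * w + k * w - y'| ≤ w ∧
          |hfunE δ u μ (XE u θ₁', YE u θ₁') x' y'| ≤ Cr * w ^ 2) ∧
        |h3E δ u P (w / 2 + i * w) (w / 2 + i * w + k * w)| < lam ∧ |h3E δ u P (w / 2 + i * w + k * w) (w / 2 + i * w)| < lam) Rrow fun i k _ hk1 _ _ hQ =>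
      fold_pos_imp B hδs heven hδ hlo hhi hκ hκ₁ hκ₂ hu hw i k hk1 hQ
  -- fold range `k w ≥ 2π − τ`
  have hC' : ∑ k ∈ (Finset.range N).filter (fun k : ℕ => 2 * π - τ ≤ (k : ℝ) * w), f k ≤ EE := by
    rw [hEE, hf]
    exact sum_fold_neg_le_of_imp hw hN (fun i k => (∃ θ₁' x' y' : ℝ, |θ₁ - θ₁'| ≤ w ∧ |w / 2 + i * w - x'| ≤ w ∧ |w / 2 + i * w + k * w - y'| ≤ w ∧
          |hfunE δ u μ (XE u θ₁', YE u θ₁') x' y'| ≤ Cr * w ^ 2) ∧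
        |h3E δ u P (w / 2 + i * w) (w / 2 + i * w + k * w)| < lam ∧ |h3E δ u P (w / 2 + i * w + k * w) (w / 2 + i * w)| < lam) Rrow fun i k _ hkN _ hQ =>
      fold_neg_imp B hδs heven hδ hlo hhi hκ hκ₁ hκ₂ hu hw hN i k hkN hQ
  -- Cooper range
  have hBo : ∑ k ∈ (Finset.range N).filter (fun k : ℕ => |(k : ℝ) * w - π| ≤ τ), f k ≤
      7 * N + (N + 2 * C₅ * ((2 * (Cc * w ^ 2) / (B.hmin / 2 * w)) * (2 * (1 + Real.log N)) / w + (2 * (K₁ * w) / (B.hmin / 2 * w)) * N + N)) := by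
    set SC := (Finset.range N).filter (fun k : ℕ => |(k : ℝ) * w - π| ≤ τ) with hSC
    rw [← Finset.sum_filter_add_sum_filter_not SC (fun k : ℕ => |(k : ℝ) * w - π| < 3 * w)]
    have htriv : ∑ k ∈ SC.filter (fun k : ℕ => |(k : ℝ) * w - π| < 3 * w), f k ≤ 7 * N := by
      have hcard : (((SC.filter (fun k : ℕ => |(k : ℝ) * w - π| < 3 * w)).card : ℝ)) ≤ 2 * 3 + 1 := by
        have : SC.filter (fun k : ℕ => |(k : ℝ) * w - π| < 3 * w) =
            (Finset.range N).filter (fun k : ℕ => |(k : ℝ) * w - π| < 3 * w ∧ |(k : ℝ) * w - π| ≤ τ) := by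
          rw [hSC, Finset.filter_filter]
          exact Finset.filter_congr fun k _ => by tauto
        rw [this]; exact card_shifts_near_pi_le hw (by norm_num) N _
      calc ∑ k ∈ SC.filter (fun k : ℕ => |(k : ℝ) * w - π| < 3 * w), f k
          ≤ ∑ k ∈ SC.filter (fun k : ℕ => |(k : ℝ) * w - π| < 3 * w), (N : ℝ) := Finset.sum_le_sum fun k _ => hfN k
        _ = (((SC.filter (fun k : ℕ => |(k : ℝ) * w - π| < 3 * w)).card : ℝ)) * N := by rw [Finset.sum_const, nsmul_eq_mul]
        _ ≤ (2 * 3 + 1) * N := mul_le_mul_of_nonneg_right hcard hN0.le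
        _ = 7 * N := by ring
    have hgood : ∑ k ∈ SC.filter (fun k : ℕ => ¬ |(k : ℝ) * w - π| < 3 * w), f k ≤
        N + 2 * C₅ * ((2 * (Cc * w ^ 2) / (B.hmin / 2 * w)) * (2 * (1 + Real.log N)) / w + (2 * (K₁ * w) / (B.hmin / 2 * w)) * N + N) := by
      have hδη : Cc * w ^ 2 + K₁ * w * τ ≤ η₀F / 2 := by
        have h1 := mul_le_mul_of_nonneg_left hw2 hCc0.le
        have : Cc * w ^ 2 + K₁ * w * τ ≤ (Cc + K₁ * τ) * w := by linarith only [h1]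
        exact this.trans hwcoop
      have hcoop : ∑ k ∈ (Finset.range N).filter (fun k : ℕ => |(k : ℝ) * w - π| ≤ τ), ((((Finset.range N).filter fun i : ℕ =>
              |hfunE δ u μ P (w / 2 + i * w) (w / 2 + i * w + k * w)| ≤ Cc * w ^ 2 + K₁ * w * |(k : ℝ) * w - π| ∧
              |h3E δ u P (w / 2 + i * w) (w / 2 + i * w + k * w)| < lam ∧
              |h3E δ u P (w / 2 + i * w + k * w) (w / 2 + i * w)| < lam).card : ℝ)) ≤
          N + 2 * C₅ * ((2 * (Cc * w ^ 2) / (B.hmin / 2 * w)) * (2 * (1 + Real.log N)) / w + (2 * (K₁ * w) / (B.hmin / 2 * w)) * N + N) := by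
        rw [hC₅]
        exact count_odd_total_affine_perturbed B hδs heven hδ hlo hhi hκ hκ₁ hκ₂ hu (P := P) (δ₀ := Cc * w ^ 2) (δ₁ := K₁ * w)
          (lam := lam) (τ := τ) hw hN hNh hNN (by positivity) (by positivity) hη₀F hlam hτ hδη hloF hhiF hodd hκA hAE hMG
      refine le_trans ?_ hcoop
      calc ∑ k ∈ SC.filter (fun k : ℕ => ¬ |(k : ℝ) * w - π| < 3 * w), f k
          ≤ ∑ k ∈ SC.filter (fun k : ℕ => ¬ |(k : ℝ) * w - π| < 3 * w), ((((Finset.range N).filter fun i : ℕ =>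
              |hfunE δ u μ P (w / 2 + i * w) (w / 2 + i * w + k * w)| ≤ Cc * w ^ 2 + K₁ * w * |(k : ℝ) * w - π| ∧
              |h3E δ u P (w / 2 + i * w) (w / 2 + i * w + k * w)| < lam ∧
              |h3E δ u P (w / 2 + i * w + k * w) (w / 2 + i * w)| < lam).card : ℝ)) := by
            refine Finset.sum_le_sum fun k hk => ?_
            rw [Finset.mem_filter, not_lt] at hk
            rw [hf]
            exact cooper_filter_card_le B hδs heven hδ hlo hhi hκ hκ₁ hκ₂ hu hw hk.2
        _ ≤ _ := Finset.sum_le_sum_of_subset_of_nonneg (Finset.filter_subset _ _) fun k _ _ => by positivity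
    linarith only [htriv, hgood]
  -- everything in the form `const / w`
  have hT : 2 * (N * CT) = 2 * (2 * π * CT) / w := by rw [hNw]; field_simp
  have hF : N + EE + EE ≤ (2 * π + 2 * KF) / w := by
    rw [add_div, hNw]
    have : EE + EE ≤ 2 * KF / w := by rw [show 2 * KF / w = KF / w + KF / w by ring]; exact add_le_add hEE_le hEE_le
    linarith only [this]
  have hlogN : 1 + Real.log N ≤ N := by
    have := Real.log_le_sub_one_of_pos hN0
    linarith only [this]
  have hO : 7 * N + (N + 2 * C₅ * ((2 * (Cc * w ^ 2) / (B.hmin / 2 * w)) * (2 * (1 + Real.log N)) / w + (2 * (K₁ * w) / (B.hmin / 2 * w)) * N + N)) ≤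
      (7 * (2 * π) + (2 * π + 2 * C₅ * (4 * Cc / (B.hmin / 2) * (2 * π) + 4 * K₁ / (B.hmin / 2) * (2 * π) + 2 * π))) / w := by
    set Lg := Real.log (N : ℝ) with hLg
    have hlogN' : 1 + Lg ≤ 2 * π / w := by rw [← hNw]; exact hlogN
    have eT1 : 2 * (Cc * w ^ 2) / (B.hmin / 2 * w) * (2 * (1 + Lg)) / w = 4 * Cc / (B.hmin / 2) * (1 + Lg) := by
      field_simp
      ring
    have eT2 : 2 * (K₁ * w) / (B.hmin / 2 * w) * (N : ℝ) = 2 * K₁ / (B.hmin / 2) * (2 * π) / w := by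
      rw [hNw]; field_simp
    have bT1 : 4 * Cc / (B.hmin / 2) * (1 + Lg) ≤ 4 * Cc / (B.hmin / 2) * (2 * π) / w := by
      have := mul_le_mul_of_nonneg_left hlogN' (by positivity : (0:ℝ) ≤ 4 * Cc / (B.hmin / 2))
      calc 4 * Cc / (B.hmin / 2) * (1 + Lg) ≤ 4 * Cc / (B.hmin / 2) * (2 * π / w) := this
        _ = _ := by ring
    have hK₁' : 2 * K₁ / (B.hmin / 2) * (2 * π) / w ≤ 4 * K₁ / (B.hmin / 2) * (2 * π) / w := by
      apply div_le_div_of_nonneg_right _ hw.le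
      apply mul_le_mul_of_nonneg_right _ (by positivity)
      apply div_le_div_of_nonneg_right _ (by positivity)
      linarith only [hK₁0]
    rw [eT1, eT2, hNw]
    have hsum : 4 * Cc / (B.hmin / 2) * (1 + Lg) + 2 * K₁ / (B.hmin / 2) * (2 * π) / w + 2 * π / w ≤
        4 * Cc / (B.hmin / 2) * (2 * π) / w + 4 * K₁ / (B.hmin / 2) * (2 * π) / w + 2 * π / w := by linarith only [bT1, hK₁']
    have hmul := mul_le_mul_of_nonneg_left hsum (by positivity : (0:ℝ) ≤ 2 * C₅)
    have e3 : (7 * (2 * π) + (2 * π + 2 * C₅ * (4 * Cc / (B.hmin / 2) * (2 * π) + 4 * K₁ / (B.hmin / 2) * (2 * π) + 2 * π))) / w =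
        7 * (2 * π / w) + (2 * π / w + 2 * C₅ * (4 * Cc / (B.hmin / 2) * (2 * π) / w + 4 * K₁ / (B.hmin / 2) * (2 * π) / w + 2 * π / w)) := by
      field_simp
    rw [e3]
    linarith only [hmul]
  have h0 : (P₀.card : ℝ) ≤ (2 * π + 2 * KF) / w + (7 * (2 * π) + (2 * π + 2 * C₅ * (4 * Cc / (B.hmin / 2) * (2 * π) + 4 * K₁ / (B.hmin / 2) * (2 * π) + 2 * π))) / w := by
    have := hP₀.trans hsplit
    linarith only [this, hA', hC', hBo, hF, hO]
  have h1w : (0 : ℝ) ≤ 1 / w := by positivity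
  have e : (2 * (2 * π * CT) + (2 * π + 2 * KF) + (7 * (2 * π) + (2 * π + 2 * C₅ * (4 * Cc / (B.hmin / 2) * (2 * π) + 4 * K₁ / (B.hmin / 2) * (2 * π) + 2 * π))) + 1) / w =
      2 * (2 * π * CT) / w + (2 * π + 2 * KF) / w +
        (7 * (2 * π) + (2 * π + 2 * C₅ * (4 * Cc / (B.hmin / 2) * (2 * π) + 4 * K₁ / (B.hmin / 2) * (2 * π) + 2 * π))) / w + 1 / w := by
    field_simp
  rw [e]
  linarith only [hcardP, hP₃, hP₂, hT, h0, h1w]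

end Summit.HubbardSuperconductivity.HubbardSuperconductivity.Theorems.PerturbedFermiCurve

end
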